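import Summits.ResolutionOfSingularities.ResolutionOfSingularities.Theorems.FrobeniusLadderFRationalResolutionGaloisIdealDescent
import Mathlib.RingTheory.Invariant.Basic
import HarnessLib

/-!
# Crux `FrobeniusLadder.FRationalResolution` (stmt-ResolutionOfSingularities-15317), line `redirect`,
# stub `stub_diagonalizableQuotientResolution` — invariants and TRANSITIVITY of the Galois twists on `B ⊗_K K'`
# (Galois route: the maximal ideals of `B ⊗_K K'` over `𝔭` form ONE orbit, so the orbit centre of `…BlowupOrbitCentre`
# covers every point over `𝔭`, and `Spec(B ⊗_K K')` is regular off that orbit when `Spec B` is regular off `𝔭`)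

* `trace_dualBasis_eq_coord_one` — bookkeeping: `Tr(d_j) = (j-th coordinate of 1)` for the trace-dual basis `d` of `e`;
* **`exists_eq_tmul_one_of_forall_map_eq`** — an element of `B ⊗_K K'` fixed by every twist `1 ⊗ σ` is of the form `b ⊗ 1`
  (`(B ⊗_K K')^{Gal} = B`; from the trace identity `…GaloisIdealDescent.sum_map_mul_dualBasis_eq`);
* **`exists_map_twist_eq_of_comap_eq`** — Gal(K'/K) acts TRANSITIVELY on the primes of `B ⊗_K K'` over a given prime of `B`
  (Mathlib `Algebra.IsInvariant.exists_smul_of_under_eq`, the action and the invariants supplied by the two items above).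

Honest label: generic commutative algebra (no stub closed by name). No definitions, no named facts, no sorry.
[cite: StacksProject, Tag 0CDQ; Tag 09EB] [folklore; cite: KMRT1998, (18.1)]
-/

noncomputable section

-- single-problem summit: the doubled namespace component is forced
set_option linter.dupNamespace false

open TensorProduct

namespace Summit.ResolutionOfSingularities.ResolutionOfSingularities.Theorems.FRationalResolution.GaloisTwistInvariants

variable {K K' B : Type} [Field K] [Field K'] [Algebra K K'] [CommRing B] [Algebra K B]

/-- Bookkeeping: for a `K`-basis `e` of `K'` with trace-dual basis `d`, `Tr(d_j)` is the `j`-th coordinate of `1`.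
[folklore] -/
theorem trace_dualBasis_eq_coord_one [FiniteDimensional K K'] [Algebra.IsSeparable K K'] {ι : Type} [Fintype ι]
    [DecidableEq ι] (e : Module.Basis ι K K') (j : ι) :
    Algebra.trace K K' ((Algebra.traceForm K K').dualBasis (traceForm_nondegenerate K K') e j) = e.repr 1 j := by
  set d := (Algebra.traceForm K K').dualBasis (traceForm_nondegenerate K K') e with hd
  conv_lhs => rw [← mul_one (d j), ← e.sum_repr 1]
  rw [Finset.mul_sum, map_sum]
  simp_rw [mul_smul_comm, map_smul, ← Algebra.traceForm_apply, hd, LinearMap.BilinForm.apply_dualBasis_left,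
    smul_eq_mul, mul_ite, mul_one, mul_zero]
  rw [Finset.sum_ite_eq' Finset.univ j fun i => e.repr 1 i]
  simp

/-- **`(B ⊗_K K')^{Gal(K'/K)} = B`.** For `K'/K` finite Galois, an element of `B ⊗_K K'` fixed by every twist `1 ⊗ σ` is
`b ⊗ 1` for some `b ∈ B`. [cite: StacksProject, Tag 0CDQ] [folklore; cite: KMRT1998, (18.1)] -/
theorem exists_eq_tmul_one_of_forall_map_eq [FiniteDimensional K K'] [IsGalois K K'] (x : B ⊗[K] K')
    (hx : ∀ σ : K' ≃ₐ[K] K', Algebra.TensorProduct.map (AlgHom.id B B) (σ : K' →ₐ[K] K') x = x) :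
    ∃ b : B, x = b ⊗ₜ[K] 1 := by
  classical
  set e := Module.finBasis K K' with he
  set d := (Algebra.traceForm K K').dualBasis (traceForm_nondegenerate K K') e with hd
  -- a coordinate of `1` is non-zero
  have h1 : ∃ j, e.repr 1 j ≠ 0 := by
    by_contra h
    simp only [not_exists, not_not] at h
    have : e.repr (1 : K') = 0 := Finsupp.ext fun j => by simpa using h j
    exact one_ne_zero (e.repr.injective (by rw [this, map_zero]))
  obtain ⟨j, hj⟩ := h1
  -- the trace identity, with `x` fixed: `Tr(d_j) • x = coord_j(x) ⊗ 1`
  have key := GaloisIdealDescent.sum_map_mul_dualBasis_eq (B := B) e j x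
  have hlhs : ∑ σ : K' ≃ₐ[K] K', Algebra.TensorProduct.map (AlgHom.id B B) (σ : K' →ₐ[K] K')
      ((1 : B) ⊗ₜ[K] d j * x) = (e.repr 1 j) • x := by
    have hσ : ∀ σ : K' ≃ₐ[K] K', Algebra.TensorProduct.map (AlgHom.id B B) (σ : K' →ₐ[K] K')
        ((1 : B) ⊗ₜ[K] d j * x) = ((1 : B) ⊗ₜ[K] σ (d j)) * x := by
      intro σ
      rw [map_mul, hx σ, Algebra.TensorProduct.map_tmul, AlgHom.id_apply, AlgEquiv.coe_toAlgHom]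
    simp_rw [hσ]
    rw [← Finset.sum_mul, ← TensorProduct.tmul_sum, ← trace_eq_sum_automorphisms, hd,
      trace_dualBasis_eq_coord_one e j, ← Algebra.TensorProduct.tmul_one_eq_one_tmul,
      ← Algebra.TensorProduct.algebraMap_apply, ← Algebra.smul_def]
  rw [hlhs] at key
  refine ⟨(e.repr 1 j)⁻¹ • (Algebra.TensorProduct.basis B e).coord j x, ?_⟩
  calc x = (e.repr 1 j)⁻¹ • ((e.repr 1 j) • x) := by rw [smul_smul, inv_mul_cancel₀ hj, one_smul]
    _ = (e.repr 1 j)⁻¹ • (algebraMap B (B ⊗[K] K') ((Algebra.TensorProduct.basis B e).coord j x)) := by rw [key]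
    _ = ((e.repr 1 j)⁻¹ • (Algebra.TensorProduct.basis B e).coord j x) ⊗ₜ[K] 1 := by
        rw [Algebra.TensorProduct.algebraMap_apply, Algebra.algebraMap_self, RingHom.id_apply, TensorProduct.smul_tmul']

/-- **Gal(K'/K) acts TRANSITIVELY on the primes of `B ⊗_K K'` over a given prime of `B`.** For `K'/K` finite Galois and
primes `P, Q ⊆ B ⊗_K K'` with the same contraction to `B`, some twist `1 ⊗ σ` carries `P` onto `Q`.
(Mathlib's `Algebra.IsInvariant.exists_smul_of_under_eq` for the twist action, whose invariants are `B` by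
`exists_eq_tmul_one_of_forall_map_eq`.) [cite: StacksProject, Tag 09EB; Tag 0CDQ] -/
theorem exists_map_twist_eq_of_comap_eq [FiniteDimensional K K'] [IsGalois K K'] (P Q : Ideal (B ⊗[K] K'))
    [P.IsPrime] [Q.IsPrime]
    (hPQ : P.comap (algebraMap B (B ⊗[K] K')) = Q.comap (algebraMap B (B ⊗[K] K'))) :
    ∃ σ : K' ≃ₐ[K] K', Q = P.map (Algebra.TensorProduct.map (AlgHom.id B B) (σ : K' →ₐ[K] K')) := by
  classical
  -- the twist action as a monoid hom into the ring automorphisms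
  let τ : (K' ≃ₐ[K] K') → (B ⊗[K] K' ≃ₐ[B] B ⊗[K] K') := fun σ =>
    Algebra.TensorProduct.congr (AlgEquiv.refl : B ≃ₐ[B] B) σ
  have hτ : ∀ σ x, τ σ x = Algebra.TensorProduct.map (AlgHom.id B B) (σ : K' →ₐ[K] K') x := by
    intro σ x
    induction x using TensorProduct.induction_on with
    | zero => simp
    | tmul b y => simp [τ, Algebra.TensorProduct.congr_apply, Algebra.TensorProduct.map_tmul]
    | add x y hx hy => rw [map_add, map_add, hx, hy]
  have hone : ∀ x, τ 1 x = x := by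
    intro x
    rw [hτ]
    induction x using TensorProduct.induction_on with
    | zero => simp
    | tmul b y => simp [Algebra.TensorProduct.map_tmul]
    | add x y hx hy => rw [map_add, hx, hy]
  have hmul : ∀ σ σ' x, τ (σ * σ') x = τ σ (τ σ' x) := by
    intro σ σ' x
    rw [hτ, hτ, hτ]
    induction x using TensorProduct.induction_on with
    | zero => simp
    | tmul b y => simp [Algebra.TensorProduct.map_tmul, AlgEquiv.mul_apply]
    | add x y hx hy => simp only [map_add, hx, hy]
  let φ : (K' ≃ₐ[K] K') →* RingAut (B ⊗[K] K') :=
    { toFun := fun σ => (τ σ).toRingEquiv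
      map_one' := by
        ext x
        exact hone x
      map_mul' := fun σ σ' => by
        ext x
        exact hmul σ σ' x }
  have hφ : ∀ σ x, φ σ x = Algebra.TensorProduct.map (AlgHom.id B B) (σ : K' →ₐ[K] K') x := fun σ x => hτ σ x
  letI : MulSemiringAction (K' ≃ₐ[K] K') (B ⊗[K] K') := MulSemiringAction.compHom (B ⊗[K] K') φ
  have hsmul : ∀ (σ : K' ≃ₐ[K] K') (x : B ⊗[K] K'),
      σ • x = Algebra.TensorProduct.map (AlgHom.id B B) (σ : K' →ₐ[K] K') x := fun σ x => hφ σ x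
  haveI : SMulCommClass (K' ≃ₐ[K] K') B (B ⊗[K] K') :=
    ⟨fun σ b x => by rw [hsmul, hsmul, map_smul]⟩
  haveI : Algebra.IsInvariant B (B ⊗[K] K') (K' ≃ₐ[K] K') :=
    ⟨fun x hx => by
      obtain ⟨b, hb⟩ := exists_eq_tmul_one_of_forall_map_eq x fun σ => by rw [← hsmul]; exact hx σ
      exact ⟨b, by rw [hb, Algebra.TensorProduct.algebraMap_apply, Algebra.algebraMap_self, RingHom.id_apply]⟩⟩
  have hunder : P.under B = Q.under B := by
    rw [Ideal.under_def, Ideal.under_def]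
    exact hPQ
  obtain ⟨σ, hσ⟩ := Algebra.IsInvariant.exists_smul_of_under_eq B (B ⊗[K] K') (K' ≃ₐ[K] K') P Q hunder
  refine ⟨σ, ?_⟩
  rw [hσ, Ideal.pointwise_smul_def]
  -- both sides are the span of the same image
  apply le_antisymm
  · rw [Ideal.map_le_iff_le_comap]
    intro x hx
    rw [Ideal.mem_comap]
    have : MulSemiringAction.toRingHom (K' ≃ₐ[K] K') (B ⊗[K] K') σ x =
        Algebra.TensorProduct.map (AlgHom.id B B) (σ : K' →ₐ[K] K') x := hsmul σ x
    rw [this]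
    exact Ideal.mem_map_of_mem _ hx
  · rw [Ideal.map_le_iff_le_comap]
    intro x hx
    rw [Ideal.mem_comap]
    have : Algebra.TensorProduct.map (AlgHom.id B B) (σ : K' →ₐ[K] K') x =
        MulSemiringAction.toRingHom (K' ≃ₐ[K] K') (B ⊗[K] K') σ x := (hsmul σ x).symm
    rw [this]
    exact Ideal.mem_map_of_mem _ hx

end Summit.ResolutionOfSingularities.ResolutionOfSingularities.Theorems.FRationalResolution.GaloisTwistInvariants

end
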